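import Summits.QuantumFields.BalabanUV.Beta.GAN24.Push4NestTable
import Summits.QuantumFields.BalabanUV.Beta.GAN24.Push4NestAux
import Summits.QuantumFields.BalabanUV.Beta.GAN24.BiStencilZeroMode

/-!
# `BalabanUV.Beta.GAN24.Push4Slices` — binder row G-an2-4 / (CONV-C), W-slot road «W3», ROW W3-F3b (T-irr) (gan24-p1-g5 `SKELETON-W3.md` v1.0.2
# §8.6 (F3-core-b); journal INTENT «W3-TIRR*» l.7944), core part 3: THE FOUR-LEG PUSH WITH THE FIRST TABLE BOND OUTERMOST —
# `push₄ l r X μ y ν y′ = vertexW r (fun κ u ↦ push₃ l r (X κ u) ν y′) μ y` (leaf-17's commutation lemmas BY NAME) — and the SLICE CHARGE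
# `sliceSum X κ u` (the inner triple sum of `BiStencilZeroMode.zmode`): its size, its `Lc`-periodicity under joint block covariance, and the
# Fubini identity from the push's nested order `(z, x, u′)` to the zero mode's order `(u′, x, z)`

NOT IN PRINT; OUR PROOF ATTEMPT ([folklore] bookkeeping over leaf-17's `Push4`∕`Push4NestTable`∕`Push4NestAux` and leaf-02's `BiStencilZeroMode` BY NAME;
TWO plumbing `def`s (`push₃`, `sliceSum`) asserting nothing; 0 cited facts, 0 `def … : Prop`, 0 wall binders).  HONEST FRAMING (cell contract, verbatim):
«discharging `BetaPertH` makes Bałaban's UV stability UNCONDITIONAL — a real constructive-QFT result; it is NOT the continuum limit and NOT the Clay problem.»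
HONEST DEPENDENCY (verbatim): «continuum YM on T⁴ ⇐ BetaPertH ∧ nine spine estimates (0/9 proved); BetaPertH ⇐ (D1) ∧ (D4) ∧ CAP+tail; G-an2-4 gates
asym, D1 and NE2/3/4.»  Discharges NOTHING of «T2Shape» ∕ «T2SupRate» ∕ (hW₂, hW₂all); NOT «W-slot closed», NEVER «G-an2-4 closed»; NOT `BetaPertH`,
NOT continuum, NOT Clay.

## Why (the shape of the (T-irr) argument)
The ONE Taylor order of SKELETON-W3 §7.3 (T-irr) is taken around the FIRST TABLE BOND `u` of the source: the three other fine positions `(u′, x, z)` of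
`X κ u κ′ u′ x z` are tied to `u` by the `LocStencil₂` decay, and the cancellation (the zero mode) is a statement about the `u`-sum of the slice
charges.  So the push must be read with `u` OUTERMOST; leaf-17's `push₄` nests it third (`ffRead ∘ (Lk l ∘ vertexW r (vertexW r X) ∘ Rk r)`), and
their dominated commutations `vertexW_comp_left` ∕ `vertexW_comp_right` ∕ `vertexW_ffRead` move it out.

## What is proved (generic `d`)
* §1 `push₃ l r Y ν y′ := ffRead (comp (comp (Lk l) (vertexW r Y ν y′)) (Rk r))` (the three-leg push of ONE slice `Y = X κ u`); `push₃_inl_inl`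
  (entry formula), `push₃_inr_left` ∕ `push₃_inr_right` (multiplier entries vanish).
* §2 **`push₄_eq_vertexW_push₃`**: legs summable in their fine index and bounded, `LocStencil₂ X C δ`, `δ > 0` ⇒
  `push₄ l r X μ y ν y′ = vertexW r (fun κ u ↦ push₃ l r (X κ u) ν y′) μ y`; `push₄_inl_inl_eq_tsum` (the same, as the entry formula
  `Σ_κ Σ'_u r μ y κ u · push₃ l r (X κ u) ν y′ x′ z′ (inl α) (inl β)`).
* §3 `sliceSum X κ u κ′ κ₁ κ₂ := Σ'_{u′} Σ'_x Σ'_z X κ u κ′ u′ x z (inl κ₁) (inl κ₂)`; `zmode_inl_inl_eq_sum_sliceSum` (leaf-02's `zmode Lc X κ κ′ (inl κ₁) (inl κ₂)`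
  `= Σ_{b ∈ box Lc} sliceSum X κ (toSite b) κ′ κ₁ κ₂`, by `rfl`); `sliceSum_add_zsmul` (`Lc`-periodicity in `u` under joint block covariance — leaf-02's
  `inner_periodic`); `abs_sliceSum_le` (`≤ C·Zl(δ)³`); summability of the inner layers; **`tsum_zxu_eq_sliceSum`** — the Fubini identity
  `Σ'_z Σ'_x Σ'_{u′} X κ u κ′ u′ x z (inl κ₁) (inl κ₂) = sliceSum X κ u κ′ κ₁ κ₂` (three product-dominated interchanges, `KernelWard.tsum_comm_of_prodBound`).
Unit `b2b-balaban-gan24-formalise-leaf-12` (G-an2-4 formalisation swarm, leaf prover 12, gen 20; ROW W3-F3b holder), 2026-08-20.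
-/

noncomputable section

open Finset
open scoped BigOperators
open Literature.MathematicalPhysics.QuantumFieldTheory
open Literature.MathematicalPhysics.QuantumFieldTheory.Balaban1983to89
open Literature.MathematicalPhysics.QuantumFieldTheory.Balaban1983to89.Beta
open B12Sec2to5 (l1 l1_nonneg)
open ExpKernelCalculus (MKer comp Decays Zl Zl_nonneg summable_exp_shift summable_exp_shift' tsum_exp_shift tsum_exp_shift' l1_sub_triangle l1_sub_symm shiftK)
open OneStepResolventKernel (Fib)
open KernelWard (ProdBound tsum_comm_of_prodBound)
open BalabanCompositeJets (LocStencil₂ LocStencil₂.nonneg summable_slice_of_locStencil₂ tsum_abs_slice_le)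
open AffineAveraging (box toSite)
open Summit.QuantumFields.BalabanUV.Beta.GAN24.Push4 (vertexW vertexW_apply vertex2W Lk Rk ffRead push₄ push₄_def Lk_inl_inl Lk_inl_inr Lk_inr
  Rk_inl_inl Rk_inr_left Rk_inr_right ffRead_inl_inl ffRead_inr_left ffRead_inr_right)
open Summit.QuantumFields.BalabanUV.Beta.GAN24.Push4NestTable (vertexW_ffRead vertexW_comp_left vertexW_comp_right)
open Summit.QuantumFields.BalabanUV.Beta.GAN24.Push4NestAux (abs_vertexW_slice_le abs_comp_Lk_le_of_decays summable_Lk_row summable_Rk_col)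
open Summit.QuantumFields.BalabanUV.Beta.GAN24.BiStencilZeroMode (Tab zmode inner_periodic)

namespace Summit.QuantumFields.BalabanUV.Beta.GAN24.Push4Slices

variable {d : ℕ}
variable (l r : Fin (d + 1) → (Fin (d + 1) → ℤ) → Fin (d + 1) → (Fin (d + 1) → ℤ) → ℝ)

/-! ## §1 The three-leg push of one slice -/

/-- [folklore] **THE THREE-LEG PUSH OF ONE SLICE** `Y` (a stencil family `Y κ′ u′`): the second table leg through `r` (`vertexW`), the two kernel legs
through `Lk l` ∕ `Rk r`, read in the ff corner — `push₃ l r Y ν y′ := ffRead (comp (comp (Lk l) (vertexW r Y ν y′)) (Rk r))`.  For `Y = X κ u` and the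
first table leg `r μ y κ u` summed outside this is leaf-17's `push₄ l r X μ y ν y′` (§2).  A definition asserting nothing. -/
def push₃ (Y : Fin (d + 1) → (Fin (d + 1) → ℤ) → MKer (d + 1) (Fib d)) (ν : Fin (d + 1)) (y' : Fin (d + 1) → ℤ) : MKer (d + 1) (Fib d) :=
  ffRead (comp (comp (Lk l) (vertexW r Y ν y')) (Rk r))

/-- [folklore] **ENTRY FORMULA** of the three-leg push:
`push₃ l r Y ν y′ x′ z′ (inl α) (inl β) = Σ'_z Σ_{κ₂} (Σ'_x Σ_{κ₁} l α x′ κ₁ x · vertexW r Y ν y′ x z (inl κ₁) (inl κ₂)) · r β z′ κ₂ z`. -/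
theorem push₃_inl_inl (Y : Fin (d + 1) → (Fin (d + 1) → ℤ) → MKer (d + 1) (Fib d)) (ν : Fin (d + 1)) (y' : Fin (d + 1) → ℤ)
    (x' z' : Fin (d + 1) → ℤ) (α β : Fin (d + 1)) :
    push₃ l r Y ν y' x' z' (Sum.inl α) (Sum.inl β)
      = ∑' z : Fin (d + 1) → ℤ, ∑ κ₂ : Fin (d + 1),
          (∑' x : Fin (d + 1) → ℤ, ∑ κ₁ : Fin (d + 1), l α x' κ₁ x * vertexW r Y ν y' x z (Sum.inl κ₁) (Sum.inl κ₂)) * r β z' κ₂ z := by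
  simp only [push₃, ffRead_inl_inl, comp]
  refine tsum_congr fun z => ?_
  rw [Fintype.sum_sum_type]
  simp only [Rk_inl_inl, Rk_inr_left, mul_zero, Finset.sum_const_zero, add_zero]
  refine Finset.sum_congr rfl fun κ₂ _ => ?_
  congr 1
  refine tsum_congr fun x => ?_
  rw [Fintype.sum_sum_type]
  simp only [Lk_inl_inl, Lk_inl_inr, zero_mul, Finset.sum_const_zero, add_zero]

/-- [folklore] Multiplier rows of the three-leg push vanish. -/
@[simp] theorem push₃_inr_left (Y : Fin (d + 1) → (Fin (d + 1) → ℤ) → MKer (d + 1) (Fib d)) (ν : Fin (d + 1)) (y' : Fin (d + 1) → ℤ)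
    (x' z' : Fin (d + 1) → ℤ) (μ' : Fin (d + 1)) (b : Fib d) : push₃ l r Y ν y' x' z' (Sum.inr μ') b = 0 := by
  simp only [push₃, ffRead_inr_left]

/-- [folklore] Multiplier columns of the three-leg push vanish. -/
@[simp] theorem push₃_inr_right (Y : Fin (d + 1) → (Fin (d + 1) → ℤ) → MKer (d + 1) (Fib d)) (ν : Fin (d + 1)) (y' : Fin (d + 1) → ℤ)
    (x' z' : Fin (d + 1) → ℤ) (a : Fib d) (ν' : Fin (d + 1)) : push₃ l r Y ν y' x' z' a (Sum.inr ν') = 0 := by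
  simp only [push₃, ffRead_inr_right]

/-! ## §2 The four-leg push with the first table bond outermost -/

variable {l r}
variable {X : Tab d} {C δ Bl Br : ℝ}

/-- [folklore] The inner vertex of a slice is bounded (leaf-17's `abs_vertexW_slice_le` with the decay factor dropped). -/
theorem abs_vertexW_slice_le_const (hrb : ∀ μ y κ u, |r μ y κ u| ≤ Br) (hBr : 0 ≤ Br) (hX : LocStencil₂ X C δ) (hδ : 0 < δ)
    (κ : Fin (d + 1)) (u : Fin (d + 1) → ℤ) (ν : Fin (d + 1)) (y' : Fin (d + 1) → ℤ) (x z : Fin (d + 1) → ℤ) (a b : Fib d) :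
    |vertexW r (X κ u) ν y' x z a b| ≤ (d + 1 : ℕ) * (Br * (C * Zl (d + 1) δ)) := by
  refine (abs_vertexW_slice_le hrb hBr hX hδ κ u ν y' x z a b).trans ?_
  have h0 : 0 ≤ (d + 1 : ℕ) * (Br * (C * Zl (d + 1) δ)) := by
    have := hX.nonneg; have := Zl_nonneg (D := d + 1) hδ; positivity
  have h1 : Real.exp (-δ * (l1 (x - u) + l1 (z - u))) ≤ 1 := by
    rw [Real.exp_le_one_iff]; nlinarith [l1_nonneg (x - u), l1_nonneg (z - u)]
  nlinarith

/-- [folklore] The inner vertex of a slice DECAYS in `|x − z|₁` at the table's rate (`|x−u|₁ + |z−u|₁ ≥ |x−z|₁`). -/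
theorem decays_vertexW_slice (hrb : ∀ μ y κ u, |r μ y κ u| ≤ Br) (hBr : 0 ≤ Br) (hX : LocStencil₂ X C δ) (hδ : 0 < δ)
    (κ : Fin (d + 1)) (u : Fin (d + 1) → ℤ) (ν : Fin (d + 1)) (y' : Fin (d + 1) → ℤ) :
    Decays (vertexW r (X κ u) ν y') ((d + 1 : ℕ) * (Br * (C * Zl (d + 1) δ))) δ := by
  intro x z a b
  refine (abs_vertexW_slice_le hrb hBr hX hδ κ u ν y' x z a b).trans ?_
  have h0 : 0 ≤ (d + 1 : ℕ) * (Br * (C * Zl (d + 1) δ)) := by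
    have := hX.nonneg; have := Zl_nonneg (D := d + 1) hδ; positivity
  refine mul_le_mul_of_nonneg_left (Real.exp_le_exp.2 ?_) h0
  have t := l1_sub_triangle x u z
  rw [l1_sub_symm u z] at t
  nlinarith [hδ.le]

/-- [folklore] **THE FOUR-LEG PUSH WITH THE FIRST TABLE BOND OUTERMOST**: for leg families summable in their fine index and bounded and a
`LocStencil₂` table, `push₄ l r X μ y ν y′ = vertexW r (fun κ u ↦ push₃ l r (X κ u) ν y′) μ y` — leaf-17's three dominated commutations
`vertexW_comp_left`, `vertexW_comp_right`, `vertexW_ffRead` applied to the `push₄` sandwich. -/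
theorem push₄_eq_vertexW_push₃ (hls : ∀ α x' κ, Summable fun x => l α x' κ x) (hrs : ∀ μ y κ, Summable fun u => r μ y κ u)
    (hlb : ∀ α x' κ x, |l α x' κ x| ≤ Bl) (hrb : ∀ μ y κ u, |r μ y κ u| ≤ Br) (hBl : 0 ≤ Bl) (hBr : 0 ≤ Br)
    (hX : LocStencil₂ X C δ) (hδ : 0 < δ) (μ : Fin (d + 1)) (y : Fin (d + 1) → ℤ) (ν : Fin (d + 1)) (y' : Fin (d + 1) → ℤ) :
    push₄ l r X μ y ν y' = vertexW r (fun κ u => push₃ l r (X κ u) ν y') μ y := by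
  -- the family of inner vertices and its bounds
  set T : Fin (d + 1) → (Fin (d + 1) → ℤ) → MKer (d + 1) (Fib d) := fun κ u => vertexW r (X κ u) ν y' with hT
  have hTb : ∀ lam v w z f b, |T lam v w z f b| ≤ (d + 1 : ℕ) * (Br * (C * Zl (d + 1) δ)) := fun lam v w z f b =>
    abs_vertexW_slice_le_const hrb hBr hX hδ lam v ν y' w z f b
  have hTdec : ∀ lam v, Decays (T lam v) ((d + 1 : ℕ) * (Br * (C * Zl (d + 1) δ))) δ := fun lam v =>
    decays_vertexW_slice hrb hBr hX hδ lam v ν y'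
  have hT'b : ∀ lam v x w a f, |comp (Lk l) (T lam v) x w a f| ≤ (d + 1 : ℕ) * (Bl * ((d + 1 : ℕ) * (Br * (C * Zl (d + 1) δ))) * Zl (d + 1) δ) :=
    fun lam v x w a f => abs_comp_Lk_le_of_decays hlb hBl (hTdec lam v) hδ x w a f
  -- step 1: the left leg kernel
  have h1 : vertexW r (fun κ u => comp (Lk l) (T κ u)) μ y = comp (Lk l) (vertexW r T μ y) :=
    vertexW_comp_left (r := r) (hrs μ y) (fun x a f => summable_Lk_row hls x a f) hTb
  -- step 2: the right leg kernel
  have h2 : vertexW r (fun κ u => comp (comp (Lk l) (T κ u)) (Rk r)) μ y = comp (vertexW r (fun κ u => comp (Lk l) (T κ u)) μ y) (Rk r) :=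
    vertexW_comp_right (r := r) (hrs μ y) (fun z f b => summable_Rk_col hrs z f b) hT'b
  -- step 3: the ff read
  have h3 : vertexW r (fun κ u => ffRead (comp (comp (Lk l) (T κ u)) (Rk r))) μ y
      = ffRead (vertexW r (fun κ u => comp (comp (Lk l) (T κ u)) (Rk r)) μ y) :=
    vertexW_ffRead (r := r) (fun κ u => comp (comp (Lk l) (T κ u)) (Rk r)) μ y
  have e0 : vertex2W r X μ y ν y' = vertexW r T μ y := rfl
  calc push₄ l r X μ y ν y' = ffRead (comp (comp (Lk l) (vertexW r T μ y)) (Rk r)) := by rw [push₄_def, e0]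
    _ = ffRead (comp (vertexW r (fun κ u => comp (Lk l) (T κ u)) μ y) (Rk r)) := by rw [h1]
    _ = ffRead (vertexW r (fun κ u => comp (comp (Lk l) (T κ u)) (Rk r)) μ y) := by rw [h2]
    _ = vertexW r (fun κ u => ffRead (comp (comp (Lk l) (T κ u)) (Rk r))) μ y := by rw [h3]
    _ = vertexW r (fun κ u => push₃ l r (X κ u) ν y') μ y := rfl

/-- [folklore] The same as an ENTRY FORMULA: `push₄ l r X μ y ν y′ x′ z′ (inl α) (inl β) = Σ_κ Σ'_u r μ y κ u · push₃ l r (X κ u) ν y′ x′ z′ (inl α) (inl β)`. -/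
theorem push₄_inl_inl_eq_tsum (hls : ∀ α x' κ, Summable fun x => l α x' κ x) (hrs : ∀ μ y κ, Summable fun u => r μ y κ u)
    (hlb : ∀ α x' κ x, |l α x' κ x| ≤ Bl) (hrb : ∀ μ y κ u, |r μ y κ u| ≤ Br) (hBl : 0 ≤ Bl) (hBr : 0 ≤ Br)
    (hX : LocStencil₂ X C δ) (hδ : 0 < δ) (μ : Fin (d + 1)) (y : Fin (d + 1) → ℤ) (ν : Fin (d + 1)) (y' : Fin (d + 1) → ℤ)
    (x' z' : Fin (d + 1) → ℤ) (α β : Fin (d + 1)) :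
    push₄ l r X μ y ν y' x' z' (Sum.inl α) (Sum.inl β)
      = ∑ κ : Fin (d + 1), ∑' u : Fin (d + 1) → ℤ, r μ y κ u * push₃ l r (X κ u) ν y' x' z' (Sum.inl α) (Sum.inl β) := by
  rw [push₄_eq_vertexW_push₃ hls hrs hlb hrb hBl hBr hX hδ, vertexW_apply]

/-! ## §3 The slice charge: the inner triple sum of the zero mode -/

/-- [folklore] **THE SLICE CHARGE** of a bi-stencil table at its first bond `(κ, u)`: `sliceSum X κ u κ′ κ₁ κ₂ := Σ'_{u′} Σ'_x Σ'_z X κ u κ′ u′ x z (inl κ₁) (inl κ₂)`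
— the inner triple sum of leaf-02's `BiStencilZeroMode.zmode` at the field–field fibre slots.  A definition asserting nothing. -/
def sliceSum (X : Tab d) (κ : Fin (d + 1)) (u : Fin (d + 1) → ℤ) (κ' κ₁ κ₂ : Fin (d + 1)) : ℝ :=
  ∑' u' : Fin (d + 1) → ℤ, ∑' x : Fin (d + 1) → ℤ, ∑' z : Fin (d + 1) → ℤ, X κ u κ' u' x z (Sum.inl κ₁) (Sum.inl κ₂)

/-- [folklore] The field–field zero mode is the cell sum of the slice charges (by `rfl`). -/
theorem zmode_inl_inl_eq_sum_sliceSum (N : ℕ) (X : Tab d) (κ κ' κ₁ κ₂ : Fin (d + 1)) :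
    zmode N X κ κ' (Sum.inl κ₁) (Sum.inl κ₂) = ∑ b ∈ box (d + 1) N, sliceSum X κ (toSite b) κ' κ₁ κ₂ := rfl

/-- [folklore] **`Lc`-PERIODICITY OF THE SLICE CHARGE** under joint block covariance (leaf-02's `inner_periodic`). -/
theorem sliceSum_add_zsmul {N : ℕ}
    (hT : ∀ κ u κ' u' t, X κ (u + (N : ℤ) • t) κ' (u' + (N : ℤ) • t) = shiftK (-((N : ℤ) • t)) (X κ u κ' u'))
    (κ : Fin (d + 1)) (u t : Fin (d + 1) → ℤ) (κ' κ₁ κ₂ : Fin (d + 1)) :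
    sliceSum X κ (u + (N : ℤ) • t) κ' κ₁ κ₂ = sliceSum X κ u κ' κ₁ κ₂ :=
  inner_periodic hT κ κ' (Sum.inl κ₁) (Sum.inl κ₂) u t

section Bounds

variable (hX : LocStencil₂ X C δ) (hδ : 0 < δ)
include hX hδ

/-- [folklore] The innermost layer: `|Σ'_z X κ u κ′ u′ x z a b| ≤ C·Zl δ·e^{−δ|u′−u|₁}·e^{−δ|x−u|₁}` and its summability. -/
theorem abs_tsum_z_le (κ : Fin (d + 1)) (u : Fin (d + 1) → ℤ) (κ' : Fin (d + 1)) (u' x : Fin (d + 1) → ℤ) (a b : Fib d) :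
    (Summable fun z : Fin (d + 1) → ℤ => X κ u κ' u' x z a b) ∧
      |∑' z : Fin (d + 1) → ℤ, X κ u κ' u' x z a b| ≤
        C * Zl (d + 1) δ * Real.exp (-δ * l1 (u' - u)) * Real.exp (-δ * l1 (x - u)) := by
  have hC : 0 ≤ C := hX.nonneg
  have hs := (summable_exp_shift' hδ u).mul_left (C * Real.exp (-δ * l1 (u' - u)) * Real.exp (-δ * l1 (x - u)))
  have hpt : ∀ z, ‖X κ u κ' u' x z a b‖ ≤ C * Real.exp (-δ * l1 (u' - u)) * Real.exp (-δ * l1 (x - u)) * Real.exp (-δ * l1 (z - u)) := by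
    intro z
    rw [Real.norm_eq_abs]
    refine (hX κ u κ' u' x z a b).trans (le_of_eq ?_)
    rw [mul_add, Real.exp_add]; ring
  refine ⟨Summable.of_norm_bounded hs hpt, ?_⟩
  have hb := tsum_of_norm_bounded hs.hasSum hpt
  rw [Real.norm_eq_abs] at hb
  refine hb.trans (le_of_eq ?_)
  rw [tsum_mul_left, tsum_exp_shift']; ring

/-- [folklore] The middle layer: `|Σ'_x Σ'_z X …| ≤ C·(Zl δ)²·e^{−δ|u′−u|₁}` and its summability. -/
theorem abs_tsum_xz_le (κ : Fin (d + 1)) (u : Fin (d + 1) → ℤ) (κ' : Fin (d + 1)) (u' : Fin (d + 1) → ℤ) (a b : Fib d) :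
    (Summable fun x : Fin (d + 1) → ℤ => ∑' z : Fin (d + 1) → ℤ, X κ u κ' u' x z a b) ∧
      |∑' x : Fin (d + 1) → ℤ, ∑' z : Fin (d + 1) → ℤ, X κ u κ' u' x z a b| ≤
        C * Zl (d + 1) δ * Zl (d + 1) δ * Real.exp (-δ * l1 (u' - u)) := by
  have hC : 0 ≤ C := hX.nonneg
  have hZ : 0 ≤ Zl (d + 1) δ := Zl_nonneg hδ
  have hs := (summable_exp_shift' hδ u).mul_left (C * Zl (d + 1) δ * Real.exp (-δ * l1 (u' - u)))
  have hpt : ∀ x, ‖∑' z : Fin (d + 1) → ℤ, X κ u κ' u' x z a b‖ ≤ C * Zl (d + 1) δ * Real.exp (-δ * l1 (u' - u)) * Real.exp (-δ * l1 (x - u)) := by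
    intro x; rw [Real.norm_eq_abs]; exact (abs_tsum_z_le hX hδ κ u κ' u' x a b).2
  refine ⟨Summable.of_norm_bounded hs hpt, ?_⟩
  have hb := tsum_of_norm_bounded hs.hasSum hpt
  rw [Real.norm_eq_abs] at hb
  refine hb.trans (le_of_eq ?_)
  rw [tsum_mul_left, tsum_exp_shift']; ring

/-- [folklore] **SIZE OF THE SLICE CHARGE**: `|sliceSum X κ u κ′ κ₁ κ₂| ≤ C·(Zl δ)³`, and summability of the outer layer. -/
theorem abs_sliceSum_le (κ : Fin (d + 1)) (u : Fin (d + 1) → ℤ) (κ' κ₁ κ₂ : Fin (d + 1)) :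
    (Summable fun u' : Fin (d + 1) → ℤ => ∑' x : Fin (d + 1) → ℤ, ∑' z : Fin (d + 1) → ℤ, X κ u κ' u' x z (Sum.inl κ₁) (Sum.inl κ₂)) ∧
      |sliceSum X κ u κ' κ₁ κ₂| ≤ C * Zl (d + 1) δ * Zl (d + 1) δ * Zl (d + 1) δ := by
  have hC : 0 ≤ C := hX.nonneg
  have hZ : 0 ≤ Zl (d + 1) δ := Zl_nonneg hδ
  have hs := (summable_exp_shift' hδ u).mul_left (C * Zl (d + 1) δ * Zl (d + 1) δ)
  have hpt : ∀ u', ‖∑' x : Fin (d + 1) → ℤ, ∑' z : Fin (d + 1) → ℤ, X κ u κ' u' x z (Sum.inl κ₁) (Sum.inl κ₂)‖ ≤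
      C * Zl (d + 1) δ * Zl (d + 1) δ * Real.exp (-δ * l1 (u' - u)) := by
    intro u'; rw [Real.norm_eq_abs]; exact (abs_tsum_xz_le hX hδ κ u κ' u' _ _).2
  refine ⟨Summable.of_norm_bounded hs hpt, ?_⟩
  have hb := tsum_of_norm_bounded hs.hasSum hpt
  rw [Real.norm_eq_abs] at hb
  unfold sliceSum
  refine hb.trans (le_of_eq ?_)
  rw [tsum_mul_left, tsum_exp_shift']

/-- [folklore] **THE FUBINI IDENTITY** from the push's nested order to the zero mode's order:
`Σ'_z Σ'_x Σ'_{u′} X κ u κ′ u′ x z (inl κ₁) (inl κ₂) = sliceSum X κ u κ′ κ₁ κ₂` (three product-dominated interchanges). -/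
theorem tsum_zxu_eq_sliceSum (κ : Fin (d + 1)) (u : Fin (d + 1) → ℤ) (κ' κ₁ κ₂ : Fin (d + 1)) :
    ∑' z : Fin (d + 1) → ℤ, ∑' x : Fin (d + 1) → ℤ, ∑' u' : Fin (d + 1) → ℤ, X κ u κ' u' x z (Sum.inl κ₁) (Sum.inl κ₂)
      = sliceSum X κ u κ' κ₁ κ₂ := by
  have hC : 0 ≤ C := hX.nonneg
  have hZ : 0 ≤ Zl (d + 1) δ := Zl_nonneg hδ
  set T : (Fin (d + 1) → ℤ) → (Fin (d + 1) → ℤ) → (Fin (d + 1) → ℤ) → ℝ := fun u' x z => X κ u κ' u' x z (Sum.inl κ₁) (Sum.inl κ₂) with hT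
  have hTle : ∀ u' x z, |T u' x z| ≤ C * Real.exp (-δ * l1 (u' - u)) * Real.exp (-δ * l1 (x - u)) * Real.exp (-δ * l1 (z - u)) := by
    intro u' x z
    refine (hX κ u κ' u' x z _ _).trans (le_of_eq ?_)
    rw [mul_add, Real.exp_add]; ring
  -- swap 1: for each `z`, `Σ'_x Σ'_{u'} = Σ'_{u'} Σ'_x`
  have s1 : ∀ z, (∑' x, ∑' u', T u' x z) = ∑' u', ∑' x, T u' x z := by
    intro z
    refine tsum_comm_of_prodBound ⟨fun x => C * Real.exp (-δ * l1 (z - u)) * Real.exp (-δ * l1 (x - u)),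
      fun u' => Real.exp (-δ * l1 (u' - u)), (summable_exp_shift' hδ u).mul_left _, summable_exp_shift' hδ u,
      fun x => by positivity, fun u' => (Real.exp_pos _).le, fun x u' => ?_⟩
    refine (hTle u' x z).trans (le_of_eq ?_); ring
  -- swap 2: `Σ'_z Σ'_{u'} H = Σ'_{u'} Σ'_z H` with `H z u' := Σ'_x T u' x z`
  have hH : ∀ z u', |∑' x, T u' x z| ≤ C * Zl (d + 1) δ * Real.exp (-δ * l1 (u' - u)) * Real.exp (-δ * l1 (z - u)) := by
    intro z u'
    have hs := (summable_exp_shift' hδ u).mul_left (C * Real.exp (-δ * l1 (u' - u)) * Real.exp (-δ * l1 (z - u)))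
    have hb := tsum_of_norm_bounded hs.hasSum (f := fun x => T u' x z) (fun x => by
      rw [Real.norm_eq_abs]; refine (hTle u' x z).trans (le_of_eq ?_); ring)
    rw [Real.norm_eq_abs] at hb
    refine hb.trans (le_of_eq ?_)
    rw [tsum_mul_left, tsum_exp_shift']; ring
  have s2 : (∑' z, ∑' u', ∑' x, T u' x z) = ∑' u', ∑' z, ∑' x, T u' x z := by
    refine tsum_comm_of_prodBound ⟨fun z => C * Zl (d + 1) δ * Real.exp (-δ * l1 (z - u)), fun u' => Real.exp (-δ * l1 (u' - u)),
      (summable_exp_shift' hδ u).mul_left _, summable_exp_shift' hδ u, fun z => by positivity, fun u' => (Real.exp_pos _).le,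
      fun z u' => ?_⟩
    refine (hH z u').trans (le_of_eq ?_); ring
  -- swap 3: for each `u'`, `Σ'_z Σ'_x = Σ'_x Σ'_z`
  have s3 : ∀ u', (∑' z, ∑' x, T u' x z) = ∑' x, ∑' z, T u' x z := by
    intro u'
    refine tsum_comm_of_prodBound ⟨fun z => C * Real.exp (-δ * l1 (u' - u)) * Real.exp (-δ * l1 (z - u)),
      fun x => Real.exp (-δ * l1 (x - u)), (summable_exp_shift' hδ u).mul_left _, summable_exp_shift' hδ u,
      fun z => by positivity, fun x => (Real.exp_pos _).le, fun z x => ?_⟩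
    refine (hTle u' x z).trans (le_of_eq ?_); ring
  calc (∑' z, ∑' x, ∑' u', T u' x z) = ∑' z, ∑' u', ∑' x, T u' x z := tsum_congr fun z => s1 z
    _ = ∑' u', ∑' z, ∑' x, T u' x z := s2
    _ = ∑' u', ∑' x, ∑' z, T u' x z := tsum_congr fun u' => s3 u'
    _ = sliceSum X κ u κ' κ₁ κ₂ := rfl

end Bounds

end Summit.QuantumFields.BalabanUV.Beta.GAN24.Push4Slices

end
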